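import Literature.AlgebraicGeometry.HodgeTheory.AbelianVarietyIdempotentImageStability
import Literature.RingTheory.Idempotents.SemiperfectSimpleModuloRadical
import HarnessLib

/-!
# The `End X`-stable abelian subvarieties of `X` correspond, inclusion-preservingly, to the two-sided ideals of `End⁰(X)`
# (Mumford §19 Cor. 2: `End⁰ X = ⊕_i M_{n_i}(D_i)`; Lam §22 Prop. (22.1)–(22.2); Lange–Rodríguez §2.9)

Layer `Literature/AlgebraicGeometry/HodgeTheory`; theorems only (no `def`, no instance, no named fact; net debt 0).  Sequel of
`HodgeTheory/AbelianVarietyCentralIdempotentImages` (`z ↦ A^{z}`: central idempotents of `End⁰ X` ≃ `End X`-stable abelian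
subvarieties) and `…IdempotentImageStability` (semiprimeness of `End⁰ X`).  §0 (rings): in a SEMISIMPLE ring every left ideal is
`R e` for an idempotent `e` acting as a right identity on it (a complement `J`, `1 = e + f`), and every TWO-SIDED ideal is `R e` for a
UNIQUE CENTRAL idempotent `e` (`e R (1 - e) = 0` because `e a ∈ I` has `e a = e a e`, then the other corner vanishes by
semiprimeness); `R e ⊆ R e'` iff `e e' = e`.  §1 (perfect field; `End⁰ X` semisimple): composing with `z ↦ A^{z}` and checking that
`z z' = z` iff `A^{z} ⊆ A^{z'}` yields an ORDER ISOMORPHISM between the two-sided ideals of `End⁰ X` (under inclusion) and the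
`End X`-stable abelian subvarieties of `X` (under inclusion of closed subsets), `R z ↦ A^{z}`; in particular `End⁰ X` has exactly as
many two-sided ideals as `X` has `End X`-stable abelian subvarieties (`2^r`).

THE PRINT.  Mumford, *Abelian Varieties* §19 Cor. 2 of Thm. 1 (p. 174); Lam, *A First Course in Noncommutative Rings* §22
Prop. (22.1)–(22.2) (pp. 326–327: central idempotents, block decomposition, ideals of a finite product of simple rings) and §21
(21.5) (p. 308); Lange–Rodríguez §2.9 (PDF p. 43: `A^{e} = Im(m e)`).

Results (namespace `Literature.AlgebraicGeometry.HodgeTheory.AbelianVariety`):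
* §0 (rings) **`exists_isIdempotentElem_span_singleton_eq`** (semisimple: every left ideal is `R e`, `x e = x` on it),
  **`exists_central_idempotent_span_singleton_eq`** (two-sided ideals of a semisimple ring are generated by central idempotents;
  `R e` is two-sided for central `e` by the tree's `RingTheory.Idempotents.isTwoSided_span_singleton_of_comm`), `span_singleton_le_span_singleton_iff_of_isIdempotentElem` (`R e ⊆ R e'` iff `e e' = e`),
  `eq_of_central_of_span_singleton_eq` (uniqueness of the central generator);
* §1 (any field) **`mul_eq_of_range_subset_range`** (`A^{z} ⊆ A^{z'}` ⟹ `z' z = z` for idempotents);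
* §2 (perfect field, every `X`) **`exists_orderIso_twoSided_ideals_stable`** ({two-sided ideals of End⁰ X} ≃o {End X-stable abelian
  subvarieties}, `R z ↦ A^{z}`), `natCard_twoSided_ideals_eq_natCard_stable`.

## References
* [MumfordAV1970] D. Mumford, *Abelian Varieties* (1970), §19 Cor. 2 of Thm. 1 (p. 174).
* [Lam2001FirstCourse] T. Y. Lam, *A First Course in Noncommutative Rings*, 2nd ed. (2001), §21 Lemma (21.5) p. 308, §22
  Prop. (22.1)–(22.2) pp. 326–327.
* [LangeRodriguez2022] H. Lange, R. E. Rodríguez, *Decomposition of Jacobians by Prym Varieties*, LNM 2310 (2022), §2.9 (PDF p. 43).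
-/

noncomputable section

universe u

open CategoryTheory CategoryTheory.Limits

namespace Literature.AlgebraicGeometry.HodgeTheory

namespace AbelianVariety

open _root_.AlgebraicGeometry
open Literature.AlgebraicGeometry.Motives Literature.AlgebraicGeometry.Motives.AbelianVariety
open Literature.RingTheory.Idempotents

/-! ## §0 Ring theory: ideals of a semisimple ring are generated by idempotents -/

section Ring

variable {R : Type*} [Ring R]

/-- **In a semisimple ring every left ideal is `R e` for an idempotent `e ∈ I` with `x e = x` for all `x ∈ I`** (take a complement
`J` of `I`, `1 = e + f`; then `x f = x - x e ∈ I ∩ J = 0`). [cite: Lam2001FirstCourse, §22 Prop. (22.1)–(22.2) pp. 326–327 and §21 p. 308] -/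
theorem exists_isIdempotentElem_span_singleton_eq [IsSemisimpleRing R] (I : Ideal R) :
    ∃ e : R, IsIdempotentElem e ∧ e ∈ I ∧ (∀ x ∈ I, x * e = x) ∧ I = Ideal.span {e} := by
  obtain ⟨J, hIJ⟩ := exists_isCompl (I : Submodule R R)
  have h1 : (1 : R) ∈ I ⊔ J := by rw [hIJ.sup_eq_top]; exact Submodule.mem_top
  obtain ⟨e, he, f, hf, hef⟩ := Submodule.mem_sup.1 h1
  have hf' : f = 1 - e := by rw [← hef, add_sub_cancel_left]
  have key : ∀ x ∈ I, x * e = x := fun x hx ↦ by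
    have hxf : x * f ∈ I ⊓ J := by
      refine ⟨?_, J.smul_mem x hf⟩
      rw [hf', mul_sub, mul_one]
      exact I.sub_mem hx (I.mul_mem_left x he)
    rw [hIJ.inf_eq_bot, Submodule.mem_bot, hf', mul_sub, mul_one, sub_eq_zero] at hxf
    exact hxf.symm
  refine ⟨e, key e he, he, key, le_antisymm (fun x hx ↦ Ideal.mem_span_singleton'.2 ⟨x, key x hx⟩) ?_⟩
  exact (Ideal.span_singleton_le_iff_mem _).2 he

/-- **Every two-sided ideal of a semisimple ring is `R e` for a CENTRAL idempotent `e`** (`e a ∈ I` gives `e a = e a e`, i.e.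
`e R (1 - e) = 0`, and the other corner vanishes by semiprimeness). [cite: Lam2001FirstCourse, §22 Prop. (22.1)–(22.2) pp. 326–327]
[cite: MumfordAV1970, §19 Cor. 2 of Thm. 1 (p. 174)] -/
theorem exists_central_idempotent_span_singleton_eq [IsSemisimpleRing R] (I : Ideal R) [I.IsTwoSided] :
    ∃ e : R, IsIdempotentElem e ∧ (∀ a, e * a = a * e) ∧ I = Ideal.span {e} := by
  obtain ⟨e, he, heI, key, hI⟩ := exists_isIdempotentElem_span_singleton_eq I
  refine ⟨e, he, (forall_comm_iff_mul_mul_one_sub_eq_zero he).2 fun a ↦ ?_, hI⟩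
  rw [mul_sub, mul_one, key (e * a) (Ideal.IsTwoSided.mul_mem_of_left a heI), sub_self]

/-- `R e ⊆ R e'` iff `e e' = e`, for an idempotent `e'`. [cite: Lam2001FirstCourse, §21 p. 308 and §22 Prop. (22.1) p. 326] -/
theorem span_singleton_le_span_singleton_iff_of_isIdempotentElem {e e' : R} (he' : IsIdempotentElem e') :
    Ideal.span ({e} : Set R) ≤ Ideal.span {e'} ↔ e * e' = e := by
  rw [Ideal.span_singleton_le_iff_mem, Ideal.mem_span_singleton']
  constructor
  · rintro ⟨a, rfl⟩
    rw [mul_assoc, he'.eq]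
  · exact fun h ↦ ⟨e, h⟩

/-- Central idempotents generating the same ideal are equal. [cite: Lam2001FirstCourse, §22 Prop. (22.1) p. 326] -/
theorem eq_of_central_of_span_singleton_eq {e e' : R} (he : IsIdempotentElem e) (hc : ∀ a, e * a = a * e)
    (he' : IsIdempotentElem e') (h : Ideal.span ({e} : Set R) = Ideal.span {e'}) : e = e' := by
  have h₁ := (span_singleton_le_span_singleton_iff_of_isIdempotentElem he').1 h.le
  have h₂ := (span_singleton_le_span_singleton_iff_of_isIdempotentElem he).1 h.ge
  rw [← h₁, hc e', h₂]

end Ring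

variable {K : Type u} [Field K]

/-! ## §1 `A^{z} ⊆ A^{z'}` forces `z' z = z` (any field) -/

section AnyField

variable {X : Motives.AbelianVariety K} {z z' : X.endAlgebra} {d d' : ℕ} {u u' : X ⟶ X}

/-- **`A^{z} ⊆ A^{z'}` implies `z' z = z`** for idempotents `z, z'` with integral multiples `d z = 1 ⊗ u`, `d' z' = 1 ⊗ u'`
(`u'` is multiplication by `d'` on `u'(X) ⊇ u(X)`, so `u ≫ u' = d' • u`). [cite: LangeRodriguez2022, §2.9 (PDF p. 43)]
[cite: Lam2001FirstCourse, §21 p. 308] -/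
theorem mul_eq_of_range_subset_range (hz'i : IsIdempotentElem z') (hd : d ≠ 0)
    (hz : algebraMap ℚ X.endAlgebra (d : ℚ) * z = endAlgebra.of X (End.of u)) (hd' : d' ≠ 0)
    (hz' : algebraMap ℚ X.endAlgebra (d' : ℚ) * z' = endAlgebra.of X (End.of u'))
    (h : Set.range (Hom.toSchemeHom u) ⊆ Set.range (Hom.toSchemeHom u')) : z' * z = z := by
  have h1 : u ≫ u' = d' • u := comp_eq_nsmul_of_range_subset (comp_self_eq_nsmul_of_isIdempotentElem hz'i hz') h
  have h2 : endAlgebra.of X (End.of u' * End.of u) = endAlgebra.of X (d' • End.of u) := by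
    rw [End.mul_def]
    exact congrArg _ h1
  rw [map_mul, map_nsmul, ← hz, ← hz', ← Nat.cast_smul_eq_nsmul ℚ, Algebra.smul_def, mul_assoc, Algebra.left_comm] at h2
  have hud : IsUnit (algebraMap ℚ X.endAlgebra (d : ℚ)) := (IsUnit.mk0 _ (Nat.cast_ne_zero.2 hd)).map _
  have hud' : IsUnit (algebraMap ℚ X.endAlgebra (d' : ℚ)) := (IsUnit.mk0 _ (Nat.cast_ne_zero.2 hd')).map _
  exact hud.mul_right_inj.1 (hud'.mul_right_inj.1 h2)

end AnyField

/-! ## §2 Two-sided ideals of `End⁰ X` ≃o `End X`-stable abelian subvarieties (perfect field) -/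

section Perfect

variable [PerfectField K] (X : Motives.AbelianVariety K)

/-- **THE TWO-SIDED IDEALS OF `End⁰ X` AND THE `End X`-STABLE ABELIAN SUBVARIETIES OF `X` ARE ORDER-ISOMORPHIC LATTICES**,
`R z ↦ A^{z}` for the central idempotent generator `z` (`d z = 1 ⊗ u`, `A^{z} = u(X)`; every abelian variety over a perfect
field). [cite: MumfordAV1970, §19 Cor. 2 of Thm. 1 (p. 174)] [cite: Lam2001FirstCourse, §22 Prop. (22.1)–(22.2) pp. 326–327]
[cite: LangeRodriguez2022, §2.9 (PDF p. 43)] -/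
theorem exists_orderIso_twoSided_ideals_stable :
    ∃ Θ : {I : Ideal X.endAlgebra // I.IsTwoSided} ≃o
        {R : Set X.X.left | ∃ (Z : Motives.AbelianVariety K) (j : Z ⟶ X), IsClosedImmersion (Hom.toSchemeHom j) ∧
          R = Set.range (Hom.toSchemeHom j) ∧ ∀ φ : X ⟶ X, Set.range (Hom.toSchemeHom (j ≫ φ)) ⊆ Set.range (Hom.toSchemeHom j)},
      ∀ (I : {I : Ideal X.endAlgebra // I.IsTwoSided}) (z : X.endAlgebra) (d : ℕ) (u : X ⟶ X), IsIdempotentElem z →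
        (∀ a, z * a = a * z) → (I : Ideal X.endAlgebra) = Ideal.span {z} → d ≠ 0 →
          algebraMap ℚ X.endAlgebra (d : ℚ) * z = endAlgebra.of X (End.of u) →
            ((Θ I : {R : Set X.X.left | ∃ (Z : Motives.AbelianVariety K) (j : Z ⟶ X), IsClosedImmersion (Hom.toSchemeHom j) ∧
              R = Set.range (Hom.toSchemeHom j) ∧ ∀ φ : X ⟶ X, Set.range (Hom.toSchemeHom (j ≫ φ)) ⊆
                Set.range (Hom.toSchemeHom j)}) : Set X.X.left) = Set.range (Hom.toSchemeHom u) := by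
  classical
  haveI := isSemisimpleRing_endAlgebra_of_perfectField X
  obtain ⟨Φ, hΦ⟩ := exists_equiv_central_idempotents_stable_subvarieties X
  have hgen : ∀ I : {I : Ideal X.endAlgebra // I.IsTwoSided}, ∃ e : X.endAlgebra, IsIdempotentElem e ∧ (∀ a, e * a = a * e) ∧
      (I : Ideal X.endAlgebra) = Ideal.span {e} := fun I ↦ by
    haveI := I.2
    exact exists_central_idempotent_span_singleton_eq I.1
  choose gen hgi hgc hgI using hgen
  choose d u hd hu using fun e : X.endAlgebra ↦ exists_algebraMap_mul_eq_of e
  let Ψ : {I : Ideal X.endAlgebra // I.IsTwoSided} → {z : X.endAlgebra | IsIdempotentElem z ∧ ∀ a, z * a = a * z} :=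
    fun I ↦ ⟨gen I, hgi I, hgc I⟩
  let Ψ' : {z : X.endAlgebra | IsIdempotentElem z ∧ ∀ a, z * a = a * z} → {I : Ideal X.endAlgebra // I.IsTwoSided} :=
    fun z ↦ ⟨Ideal.span {(z : X.endAlgebra)}, isTwoSided_span_singleton_of_comm z.2.2⟩
  have hΨΨ' : ∀ I, Ψ' (Ψ I) = I := fun I ↦ Subtype.ext (hgI I).symm
  have hΨ'Ψ : ∀ z, Ψ (Ψ' z) = z := fun z ↦ Subtype.ext
    (eq_of_central_of_span_singleton_eq (hgi _) (hgc _) z.2.1 (hgI (Ψ' z)).symm)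
  let Θ₀ : {I : Ideal X.endAlgebra // I.IsTwoSided} ≃
      {R : Set X.X.left | ∃ (Z : Motives.AbelianVariety K) (j : Z ⟶ X), IsClosedImmersion (Hom.toSchemeHom j) ∧
        R = Set.range (Hom.toSchemeHom j) ∧ ∀ φ : X ⟶ X, Set.range (Hom.toSchemeHom (j ≫ φ)) ⊆ Set.range (Hom.toSchemeHom j)} :=
    (⟨Ψ, Ψ', hΨΨ', hΨ'Ψ⟩ : _ ≃ _).trans Φ
  have hΘ₀ : ∀ I, (Θ₀ I : Set X.X.left) = Set.range (Hom.toSchemeHom (u (gen I))) := fun I ↦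
    hΦ (Ψ I) (d _) (u _) (hd _) (hu _)
  refine ⟨{ toEquiv := Θ₀, map_rel_iff' := ?_ }, fun I z d' u' hzi hc hI hd' hz' ↦ ?_⟩
  · intro I I'
    change (Θ₀ I : Set X.X.left) ⊆ (Θ₀ I' : Set X.X.left) ↔ (I : Ideal X.endAlgebra) ≤ (I' : Ideal X.endAlgebra)
    rw [hΘ₀, hΘ₀, hgI I, hgI I', span_singleton_le_span_singleton_iff_of_isIdempotentElem (hgi I')]
    constructor
    · intro h
      rw [hgc I]
      exact mul_eq_of_range_subset_range (hgi I') (hd _) (hu _) (hd _) (hu _) h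
    · intro h
      exact range_subset_range_of_mul_eq (hu _) (hd _) (hu _) (by rw [← hgc I]; exact h)
  · have hz : gen I = z := eq_of_central_of_span_singleton_eq (hgi I) (hgc I) hzi ((hgI I).symm.trans hI)
    change (Θ₀ I : Set X.X.left) = _
    rw [hΘ₀]
    subst hz
    exact range_eq_range_of_algebraMap_mul_eq (hd _) (hu _) hd' hz'

/-- **`End⁰ X` has exactly as many two-sided ideals as `X` has `End X`-stable abelian subvarieties** (`Nat.card`; `2^r` with `r`
the number of isotypic components; perfect field). [cite: Lam2001FirstCourse, §22 Prop. (22.1)–(22.2) pp. 326–327]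
[cite: MumfordAV1970, §19 Cor. 2 of Thm. 1 (p. 174)] -/
theorem natCard_twoSided_ideals_eq_natCard_stable :
    Nat.card {I : Ideal X.endAlgebra // I.IsTwoSided} =
      Nat.card {R : Set X.X.left | ∃ (Z : Motives.AbelianVariety K) (j : Z ⟶ X), IsClosedImmersion (Hom.toSchemeHom j) ∧
        R = Set.range (Hom.toSchemeHom j) ∧ ∀ φ : X ⟶ X, Set.range (Hom.toSchemeHom (j ≫ φ)) ⊆ Set.range (Hom.toSchemeHom j)} := by
  obtain ⟨Θ, -⟩ := exists_orderIso_twoSided_ideals_stable X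
  exact Nat.card_congr Θ.toEquiv

end Perfect

end AbelianVariety

end Literature.AlgebraicGeometry.HodgeTheory

end
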